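import Literature.Computability.Complexity.CookLevinReduction
import Literature.Computability.Complexity.CookLevin
import HarnessLib

/-!
# The Cook–Levin theorem for `SAT`: every language in `NP` Karp-reduces to `SAT` (Arora–Barak Lemma 2.11)

Discharge of the named fact `Literature.PNP.SAT_isNPHard : IsNPHard SAT` (`CookLevin.lean`;
Arora–Barak 2009, Lemma 2.11, "SAT is NP-hard") as `SAT_isNPHard_holds`, on top of the tree's
Cook–Levin tableau:

* `CookLevinTableau.lean` — the tableau CNF `Tableau.tableauCNF M P T x` of a polynomial-time
  `FinTM2` verifier and its correctness `Tableau.satisfiable_tableauCNF_iff` ("the form feeding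
  `SAT`");
* `CookLevinReduction.lean` — the clause schemata `Sch` computing these clause families
  (`clauses_nS`, `clauses_bitS`), the unary variable names `uname` (`encodeNat (uname m) = 1ᵐ`),
  and the reduction `x ↦ encode (¬χₓ)` of `coNP` to `TAUT`;
* `GenProgramsInput.lean` — generator programs with input access are polynomial time
  (`GenProg.outI_mem_FP`).

The only new ingredient is the **emitter of the `encodingCNF`-code** (`CNF.lean`:
`listBool (listBool (pairBool encodingNatBool encodingBoolBool))`) of a schema's clause list
(`Sch.stmtC`, correspondence `Sch.out_stmtC`), in place of the prefix code of `PropForm.ofCNF`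
emitted by `Sch.stmt`: with unary names every numeral is a run of ones, every clause of `k`
literals contributes the block `1^{4k} 0011 · (1^{8m} 0⁴1⁴b⁴0011 per literal) · 01`
(`clauseBlock_unames`), and the whole code is the doubled unary clause count, `01`, and the
blocks (`encode_eq_header_append`); the clause count of a schema is a counter expression
(`Sch.countE`, `Sch.length_clauses`). The reduction `reduceSAT M p q x = encode χₓ`
(`χₓ` the tableau CNF with renamed variables) is then in `FP` (`reduceSAT_mem_FP`) and correct
(`reduceSAT_mem_SAT_iff`), whence Lemma 2.11 (`SAT_isNPHard_holds`) and, given `SAT ∈ NP`,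
Thm. 2.10 (1) (`isNPComplete_SAT_of_SAT_mem_NP`, via `isNPComplete_SAT_of` of `CookLevin.lean`).

## References

* S. Arora, B. Barak, *Computational Complexity: A Modern Approach*, CUP 2009, Thm. 2.10,
  Lemma 2.11, §2.3.4 (PDF pp. 67–72: "this CNF formula can be computed in time polynomial in
  the running time of `M`"), §0.1 (codes).
* S. A. Cook, *The complexity of theorem-proving procedures*, Proc. 3rd STOC (1971), Thm. 1.
* M. Sipser, *Introduction to the Theory of Computation*, 3rd ed. 2012, Thm. 7.37.
-/

namespace Literature.Computability.Complexity

open _root_.Computability Polynomial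

namespace CookLevin

/-! ### The flat `encodingCNF`-code of a CNF -/

-- Doubling every bit, `dbl` (the first component of `boolPair`), is `Literature.Computability.Complexity.SProg.dbl` of
-- `StackMachines.lean` (with `dbl_nil`, `dbl_cons`, `length_dbl`).
open SProg (dbl dbl_cons dbl_nil)

/-- `boolPair x y = dbl x ++ 0 1 y`, for the bit doubling `SProg.dbl` of `StackMachines.lean` (local copy
of `LPD.boolPair_eq` / `ShorFactPost.boolPair_eq_dbl`, which live in files not imported here; to be
hoisted next to `SProg.dbl`). [cite: AroraBarakCC2009, §0.1] -/
theorem boolPair_eq_dbl (x y : List Bool) : boolPair x y = dbl x ++ false :: true :: y := by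
  simp [boolPair, SProg.dbl]

/-- `dbl` of an append (local copy of `LPD.dbl_append` / `DropParamsTM.dbl_append`, not imported here;
to be hoisted next to `SProg.dbl`). [folklore] -/
@[simp] theorem dbl_append (v w : List Bool) : dbl (v ++ w) = dbl v ++ dbl w := by
  simp [SProg.dbl, List.flatMap_append]

/-- `dbl` commutes with `flatMap` (to be hoisted next to `SProg.dbl`). [folklore] -/
theorem dbl_flatMap {α : Type} (l : List α) (f : α → List Bool) :
    dbl (l.flatMap f) = l.flatMap fun a => dbl (f a) := by
  induction l with
  | nil => rfl
  | cons a l ih => simp [List.flatMap_cons, ih]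

/-- `dbl` of a run is a run of twice the length (local copy of `RevDesc.dbl_replicate`, not imported
here; to be hoisted next to `SProg.dbl`). [folklore] -/
@[simp] theorem dbl_replicate (n : ℕ) (b : Bool) : dbl (List.replicate n b) = List.replicate (2 * n) b := by
  induction n with
  | zero => rfl
  | succ n ih =>
    rw [List.replicate_succ, dbl_cons, ih, show 2 * (n + 1) = 2 * n + 1 + 1 by ring,
      List.replicate_succ, List.replicate_succ]

/-- The `foldr` of `boolPair` in the list code is a `flatMap` of blocks `dbl w ++ 01`.
[cite: AroraBarakCC2009, §0.1] -/
theorem foldr_boolPair_eq_flatMap {α : Type} (e : α → List Bool) (l : List α) :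
    l.foldr (fun a acc => boolPair (e a) acc) [] = l.flatMap fun a => dbl (e a) ++ [false, true] := by
  induction l with
  | nil => rfl
  | cons a l ih => rw [List.foldr_cons, ih, boolPair_eq_dbl, List.flatMap_cons]; simp

/-- The code of a literal. [cite: AroraBarakCC2009, §0.1] -/
theorem encodingLiteral_encode (l : Literal ℕ) :
    encodingLiteral.encode l = dbl (encodeNat l.1) ++ [false, true, l.2] := by
  rcases l with ⟨v, b⟩
  simp [encodingLiteral, Encoding.pairBool, boolPair_eq_dbl, encodingNatBool, encodingBoolBool, encodeBool]

/-- The block contributed by a clause to the code of a CNF: `dbl (code c) ++ 01`.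
[cite: AroraBarakCC2009, §0.1] -/
def clauseBlock (c : Clause ℕ) : List Bool :=
  dbl (encodingClause.encode c) ++ [false, true]

/-- **The code of a CNF, flat**: doubled unary clause count, separator, clause blocks.
[cite: AroraBarakCC2009, §0.1] -/
theorem encode_eq_header_append (φ : CNF ℕ) :
    encodingCNF.encode φ = List.replicate (2 * φ.length) true ++ [false, true] ++ φ.flatMap clauseBlock := by
  show boolPair (unaryEncodeNat φ.length)
    (φ.foldr (fun a acc => boolPair (encodingClause.encode a) acc) []) = _
  rw [foldr_boolPair_eq_flatMap, boolPair_eq_dbl, unaryEncodeNat_eq_replicate, dbl_replicate,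
    List.append_assoc]
  rfl

/-- The block of the literal `(uname m, b)` inside a clause block: `1^{8m} 0⁴ 1⁴ b⁴ 0011`.
[folklore] -/
def litBlock (m : ℕ) (b : Bool) : List Bool :=
  List.replicate (8 * m) true ++
    [false, false, false, false, true, true, true, true, b, b, b, b, false, false, true, true]

/-- **The block of a clause on unary-name variables**: for the clause with literals
`(uname mᵢ, bᵢ)`, `clauseBlock = 1^{4k} 0011 ++ litBlock m₁ b₁ ++ ⋯ ++ litBlock m_k b_k ++ 01`.
[folklore] -/
theorem clauseBlock_unames (ls : List (ℕ × Bool)) :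
    clauseBlock (ls.map fun l => (uname l.1, l.2)) =
      List.replicate (4 * ls.length) true ++ [false, false, true, true] ++
        ls.flatMap (fun l => litBlock l.1 l.2) ++ [false, true] := by
  show dbl (boolPair (unaryEncodeNat (ls.map fun l => (uname l.1, l.2)).length)
    ((ls.map fun l => (uname l.1, l.2)).foldr (fun a acc => boolPair (encodingLiteral.encode a) acc) [])) ++
      [false, true] = _
  rw [foldr_boolPair_eq_flatMap, boolPair_eq_dbl, unaryEncodeNat_eq_replicate, List.length_map,
    List.flatMap_map]
  simp only [dbl_append, dbl_replicate, dbl_cons, dbl_nil, dbl_flatMap, encodingLiteral_encode,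
    encodeNat_uname, litBlock, List.append_assoc, List.cons_append, List.nil_append]
  have e8 : ∀ u : ℕ, 2 * (4 * u) = 8 * u := fun u => by ring
  have e4 : ∀ u : ℕ, 2 * (2 * u) = 4 * u := fun u => by ring
  simp only [e4, e8]

/-! ### The `encodingCNF` emitter of clause schemata -/

namespace Sch

variable {V W : Type} [DecidableEq V] (MM : ℕ) (idxW : W → ℕ) (rr : V)

/-- The counted loop emitting the run `1^{8 (e MM + idx w)}` of the literal on block `e`, value
`w` (its numeral, three times doubled). [folklore] -/
def varRun (e : GExpr V) (w : W) : GStmt V Bool :=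
  GStmt.loop rr (GExpr.mul (GExpr.const 8) (GExpr.add (GExpr.mul e (GExpr.const MM)) (GExpr.const (idxW w))))
    (GStmt.emit [true])

/-- The statement emitting the block of the literal `(ren (e, w), b)`. [folklore] -/
def litStmtC (b : Bool) (e : GExpr V) (w : W) : GStmt V Bool :=
  GStmt.seq (varRun MM idxW rr e w)
    (GStmt.emit [false, false, false, false, true, true, true, true, b, b, b, b, false, false, true, true])

/-- The statement emitting the literal blocks of one polarity. [folklore] -/
def litsStmtC (b : Bool) : List (GExpr V × W) → GStmt V Bool
  | [] => GStmt.emit []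
  | q :: l => GStmt.seq (litStmtC MM idxW rr b q.1 q.2) (litsStmtC b l)

/-- The statement emitting the clause block of an expression clause: header `1^{4k} 0011`,
negative literals, positive literals, `01`. [folklore] -/
def clauseStmtC (c : ClauseE V W) : GStmt V Bool :=
  GStmt.seq (GStmt.emit (List.replicate (4 * (c.1.length + c.2.length)) true ++ [false, false, true, true]))
    (GStmt.seq (litsStmtC MM idxW rr false c.1) (GStmt.seq (litsStmtC MM idxW rr true c.2)
      (GStmt.emit [false, true])))

/-- **The `encodingCNF` emitter of a schema** (same loop structure as `Sch.stmt`).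
[cite: AroraBarakCC2009, Lemma 2.11 (proof, §2.3.4)] -/
def stmtC : Sch V W → GStmt V Bool
  | cls L => stmts (L.map (clauseStmtC MM idxW rr))
  | seq a b => GStmt.seq a.stmtC b.stmtC
  | loop i e body => GStmt.loop i e body.stmtC

/-- The clause block of a clause after renaming. [folklore] -/
def clBlock (cl : HClause (ℕ × W)) : List Bool :=
  clauseBlock ((HClause.toClause cl).map (renLit (ren MM idxW)))

/-! #### Correspondence -/

/-- `varRun` emits the run of the literal. [folklore] -/
theorem out_varRun (e : GExpr V) (w : W) (env : V → ℕ) :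
    (varRun MM idxW rr e w).out env = List.replicate (8 * (e.eval env * MM + idxW w)) true := by
  simp [varRun, GStmt.out, flatMap_range_true, GExpr.eval]

/-- `litsStmtC` emits the literal blocks. [folklore] -/
theorem out_litsStmtC (b : Bool) (env : V → ℕ) : ∀ l : List (GExpr V × W),
    (litsStmtC MM idxW rr b l).out env = l.flatMap fun q => litBlock (q.1.eval env * MM + idxW q.2) b
  | [] => rfl
  | q :: l => by
    rw [litsStmtC, GStmt.out, out_litsStmtC b env l, List.flatMap_cons, litStmtC, GStmt.out, out_varRun]
    rfl

/-- `clauseStmtC` emits the clause block of the evaluated clause. [folklore] -/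
theorem out_clauseStmtC (env : V → ℕ) (c : ClauseE V W) :
    (clauseStmtC MM idxW rr c).out env = clBlock MM idxW (evalCl env c) := by
  have e : (HClause.toClause (evalCl env c)).map (renLit (ren MM idxW)) =
      ((c.1.map fun q => (q.1.eval env * MM + idxW q.2, false)) ++
        (c.2.map fun q => (q.1.eval env * MM + idxW q.2, true))).map fun l => (uname l.1, l.2) := by
    simp [HClause.toClause, evalCl, renLit, ren, List.map_map, Function.comp_def]
  rw [clBlock, e, clauseBlock_unames]
  simp [clauseStmtC, GStmt.out, out_litsStmtC, List.flatMap_append, List.flatMap_map, List.append_assoc]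

/-- **Correspondence**: the emitter of a schema emits the clause blocks of its clauses, in
order. [cite: AroraBarakCC2009, Lemma 2.11 (proof, §2.3.4)] -/
theorem out_stmtC : ∀ (s : Sch V W) (env : V → ℕ),
    (s.stmtC MM idxW rr).out env = (s.clauses env).flatMap (clBlock MM idxW)
  | cls L, env => by
    rw [stmtC, out_stmts, clauses, List.flatMap_map]
    simp only [List.flatMap_map, out_clauseStmtC]
  | seq a b, env => by
    rw [stmtC, GStmt.out, out_stmtC a, out_stmtC b, clauses, List.flatMap_append]
  | loop i e body, env => by
    rw [stmtC, GStmt.out, clauses, List.flatMap_assoc]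
    congr 1
    funext k
    exact out_stmtC body _

/-! #### Loop variables -/

omit [DecidableEq V] in
/-- The emitters of literals of one polarity have the same loop indices in both codes. [folklore] -/
theorem loopVars_litsStmtC (b : Bool) : ∀ l : List (GExpr V × W),
    (litsStmtC MM idxW rr b l).loopVars = (litsStmt MM idxW rr b l).loopVars
  | [] => rfl
  | q :: l => by
    simp only [litsStmtC, litsStmt, litStmtC, litStmt, varRun, varStmt, GStmt.loopVars, loopVars_litsStmtC b l]
    simp

omit [DecidableEq V] in
/-- **The `encodingCNF` emitter has the same loop indices as the `encodingPropForm` emitter.**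
[folklore] -/
theorem loopVars_stmtC : ∀ s : Sch V W, (s.stmtC MM idxW rr).loopVars = (s.stmt MM idxW rr).loopVars
  | cls L => by
    rw [stmtC, stmt, loopVars_stmts, loopVars_stmts, List.flatMap_map, List.flatMap_map]
    refine List.flatMap_congr fun c _ => ?_
    simp [clauseStmtC, clauseStmt, GStmt.loopVars, loopVars_litsStmtC]
  | seq a b => by rw [stmtC, stmt, GStmt.loopVars, GStmt.loopVars, loopVars_stmtC a, loopVars_stmtC b]
  | loop i e body => by rw [stmtC, stmt, GStmt.loopVars, GStmt.loopVars, loopVars_stmtC body]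

/-- `litsStmtC` has no reuse. [folklore] -/
theorem noReuse_litsStmtC (b : Bool) : ∀ l : List (GExpr V × W), (litsStmtC MM idxW rr b l).noReuse = true
  | [] => rfl
  | q :: l => by
    simp [litsStmtC, litStmtC, varRun, GStmt.noReuse, GStmt.loopVars, noReuse_litsStmtC b l]

/-- **A well-formed schema compiles to an emitter without reuse of loop indices.** [folklore] -/
theorem noReuse_stmtC : ∀ {s : Sch V W}, s.ok rr → (s.stmtC MM idxW rr).noReuse = true
  | cls L, _ => by
    refine noReuse_stmts fun s hs => ?_
    obtain ⟨c, -, rfl⟩ := List.mem_map.1 hs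
    simp [clauseStmtC, GStmt.noReuse, noReuse_litsStmtC]
  | seq a b, h => by
    simp only [stmtC, GStmt.noReuse, Bool.and_eq_true]
    exact ⟨noReuse_stmtC h.1, noReuse_stmtC h.2⟩
  | loop i e body, h => by
    simp only [stmtC, GStmt.noReuse, Bool.and_eq_true, decide_eq_true_eq]
    refine ⟨fun hm => ?_, noReuse_stmtC h.2.2⟩
    rw [loopVars_stmtC] at hm
    rcases mem_loopVars_stmt MM idxW rr hm with h' | h'
    · exact h.1 h'
    · exact h.2.1 h'

/-! #### The number of clauses -/

omit [DecidableEq V] in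
/-- The clause count of a schema, as a counter expression (valid for `BoundsFree` schemata).
[folklore] -/
def countE : Sch V W → GExpr V
  | cls L => GExpr.const L.length
  | seq a b => GExpr.add a.countE b.countE
  | loop _ e body => GExpr.mul e body.countE

omit [DecidableEq V] in
/-- The clause count mentions only free variables. [folklore] -/
theorem countE_vars {F : V → Prop} : ∀ {s : Sch V W}, s.BoundsFree F → ∀ v ∈ s.countE.vars, F v
  | cls L, _, v, h => by simp [countE, GExpr.vars] at h
  | seq a b, h, v, hv => by
    simp only [countE, GExpr.vars, List.mem_append] at hv
    exact hv.elim (countE_vars h.1 v) (countE_vars h.2 v)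
  | loop i e body, h, v, hv => by
    simp only [countE, GExpr.vars, List.mem_append] at hv
    exact hv.elim (h.2.1 v) (countE_vars h.2.2.2 v)

/-- **The clause count computes the number of clauses** of a `BoundsFree` schema. [folklore] -/
theorem length_clauses {F : V → Prop} : ∀ {s : Sch V W} (_ : s.BoundsFree F) (env : V → ℕ),
    (s.clauses env).length = s.countE.eval env
  | cls L, _, env => by simp [clauses, countE, GExpr.eval]
  | seq a b, h, env => by
    simp only [clauses, countE, GExpr.eval, List.length_append, length_clauses h.1, length_clauses h.2]
  | loop i e body, h, env => by
    obtain ⟨hi, -, -, hb⟩ := h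
    have hcv := countE_vars hb
    simp only [clauses, countE, GExpr.eval]
    generalize e.eval env = N
    induction N with
    | zero => simp
    | succ N ih =>
      rw [List.range_succ, List.flatMap_append, List.length_append, ih, List.flatMap_singleton,
        length_clauses hb, GExpr.eval_update_of_not_mem env N (fun hm => hi (hcv _ hm))]
      ring

end Sch

/-! ### The reduction to `SAT` -/

section Concrete

open Tableau Turing

variable (M : TM2ComputableAux Bool Bool) (p q : Polynomial ℕ)

/-- **The Cook–Levin CNF of `x`, over `ℕ`**: the tableau CNF with certificate bound `p(n)` and time
bound `q(N)`, its block variables renamed into unary names. [cite: AroraBarakCC2009, Lemma 2.11] -/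
noncomputable def cnfN (x : List Bool) : CNF ℕ :=
  (tableauCNF M (PP p x.length) (TT p q x.length) x).map fun c => c.map (renLit (renM M))

/-- **The reduction to `SAT`**: `x ↦ encode φₓ` (Arora–Barak 2009, §2.3.4). [cite: AroraBarakCC2009, Lemma 2.11] -/
noncomputable def reduceSAT (x : List Bool) : List Bool :=
  encodingCNF.encode (cnfN M p q x)

/-- The clause count: `2n` bit clauses and the `n`-clauses. [folklore] -/
noncomputable def countExpr : GExpr CV :=
  GExpr.add (GExpr.mul (GExpr.const 2) X0) ((nS M p q).countE)

/-- First part of the output: the doubled unary clause count and the separator. [folklore] -/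
noncomputable def P1C : GStmt CV Bool :=
  GStmt.seq (GStmt.loop CV.rr (countExpr M p q) (GStmt.emit [true, true])) (GStmt.emit [false, true])

/-- Last part of the output: the clause blocks of the `n`-clauses. [folklore] -/
noncomputable def P3C : GStmt CV Bool :=
  (nS M p q).stmtC (MMv M) (idxV M) CV.rr

/-- The bit-loop bodies: the clause blocks of the two clauses of an input bit. [folklore] -/
noncomputable def stbC (b : Bool) : GStmt CV Bool := (bitS M p q b).stmtC (MMv M) (idxV M) CV.rr

variable {M p q}

/-- The number of bit clauses: `2` per bit. [folklore] -/
theorem length_xClauses (n Pn Tn : ℕ) : ∀ (x : List Bool) (m : ℕ),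
    ((x.zipIdx m).flatMap fun bi => bitClauses M n Pn Tn bi.1 bi.2).length = 2 * x.length
  | [], m => rfl
  | b :: x, m => by
    rw [List.zipIdx_cons, List.flatMap_cons, List.length_append, length_xClauses n Pn Tn x (m + 1)]
    simp [bitClauses]; ring

/-- **The number of clauses of `φₓ` is the value of the count expression.** [folklore] -/
theorem length_cnfN (x : List Bool) :
    (cnfN M p q x).length = (countExpr M p q).eval (GenProg.initEnv CV.x0 x.length) := by
  have hn : GenProg.initEnv CV.x0 x.length CV.x0 = x.length := GenProg.initEnv_self _ _
  rw [cnfN, List.length_map, tableauCNF, HClause.cnfOf, List.length_map, clauses, List.length_append, xClauses,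
    length_xClauses _ _ _ x 0, ← clauses_nS _ hn, Sch.length_clauses boundsFree_nS]
  simp [countExpr, GExpr.eval, X0]

/-- **The code of `φₓ`**: header, then the clause blocks of all clauses. [folklore] -/
theorem encode_cnfN (x : List Bool) :
    encodingCNF.encode (cnfN M p q x) = List.replicate (2 * (cnfN M p q x).length) true ++ [false, true] ++
      (clauses M (PP p x.length) (TT p q x.length) x).flatMap (Sch.clBlock (MMv M) (idxV M)) := by
  rw [encode_eq_header_append]
  congr 1
  rw [cnfN, tableauCNF, HClause.cnfOf, List.map_map, List.flatMap_map]
  rfl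

/-- **The bit loop emits the clause blocks of the bit clauses.** [folklore] -/
theorem bitsOutC_eq (x : List Bool) : ∀ (z : List Bool) (m : ℕ),
    GenProg.bitsOut (GenProg.initEnv CV.x0 x.length) CV.cc (stbC M p q true) (stbC M p q false) z m =
      ((z.zipIdx m).flatMap fun bi => bitClauses M x.length (PP p x.length) (TT p q x.length)
        bi.1 bi.2).flatMap (Sch.clBlock (MMv M) (idxV M))
  | [], m => rfl
  | b :: z, m => by
    have hn : Function.update (GenProg.initEnv CV.x0 x.length) CV.cc m CV.x0 = x.length := by
      rw [Function.update_of_ne (by decide)]; exact GenProg.initEnv_self _ _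
    rw [GenProg.bitsOut, bitsOutC_eq x z (m + 1), List.zipIdx_cons, List.flatMap_cons, List.flatMap_append]
    congr 1
    cases b <;> simp only [cond_true, cond_false, stbC, Sch.out_stmtC, clauses_bitS _ hn, Function.update_self]

/-- **The stream identity**: the generator with input access emits exactly `encode φₓ`.
[cite: AroraBarakCC2009, Lemma 2.11 (proof, §2.3.4)] -/
theorem outI_eq_reduceSAT (x : List Bool) :
    GenProg.outI CV.x0 CV.cc (P1C M p q) (P3C M p q) (stbC M p q true) (stbC M p q false) x =
      reduceSAT M p q x := by
  have hn : GenProg.initEnv CV.x0 x.length CV.x0 = x.length := GenProg.initEnv_self _ _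
  rw [reduceSAT, encode_cnfN, length_cnfN, GenProg.outI, bitsOutC_eq, clauses, xClauses]
  simp only [P1C, P3C, GStmt.out, flatMap_range_tt2, Sch.out_stmtC, clauses_nS _ hn, List.flatMap_append,
    List.append_assoc, List.cons_append, List.nil_append]

/-! #### Polynomial time -/

/-- Loop indices of the bit-loop bodies. [folklore] -/
theorem loopVars_stbC {v : CV} (b : Bool) (h : v ∈ (stbC M p q b).loopVars) : v = CV.rr := by
  rw [stbC, Sch.loopVars_stmtC] at h
  exact loopVars_stb b h

/-- Loop indices of `P3C`. [folklore] -/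
theorem loopVars_P3C {v : CV} (h : v ∈ (P3C M p q).loopVars) : v = CV.rr ∨ v = CV.ti ∨ v = CV.ji := by
  rw [P3C, Sch.loopVars_stmtC] at h
  exact loopVars_P3 (by simpa [P3, GStmt.loopVars] using h)

/-- The variable conditions of the generator. [folklore] -/
theorem wfIC : GenProg.WfI CV.x0 CV.cc (P1C M p q) (P3C M p q) (stbC M p q true) (stbC M p q false) where
  ne := by decide
  x₀_P₁ := by simp [P1C, GStmt.loopVars]
  x₀_P₃ h := by rcases loopVars_P3C h with h | h | h <;> cases h
  x₀_st h := by cases loopVars_stbC _ h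
  x₀_sf h := by cases loopVars_stbC _ h
  c_P₁ := by simp [P1C, GStmt.loopVars]
  c_P₃ h := by rcases loopVars_P3C h with h | h | h <;> cases h
  c_st h := by cases loopVars_stbC _ h
  c_sf h := by cases loopVars_stbC _ h
  nr_P₁ := by simp [P1C, GStmt.noReuse, GStmt.loopVars]
  nr_P₃ := Sch.noReuse_stmtC _ _ _ ok_nS
  nr_st := Sch.noReuse_stmtC _ _ _ trivial
  nr_sf := Sch.noReuse_stmtC _ _ _ trivial

variable (M p q) in
/-- **The reduction is polynomial-time computable**: `(x ↦ encode φₓ) ∈ FP` (Arora–Barak 2009,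
§2.3.4: "this CNF formula can be computed in time polynomial in the running time of `M`").
[cite: AroraBarakCC2009, Lemma 2.11 (proof, §2.3.4)] -/
theorem reduceSAT_mem_FP : reduceSAT M p q ∈ FP := by
  have he : reduceSAT M p q =
      GenProg.outI CV.x0 CV.cc (P1C M p q) (P3C M p q) (stbC M p q true) (stbC M p q false) :=
    funext fun x => (outI_eq_reduceSAT (M := M) (p := p) (q := q) x).symm
  rw [he]
  exact GenProg.outI_mem_FP (V := CV) CV.x0 CV.cc (P1C M p q) (P3C M p q) (stbC M p q true)
    (stbC M p q false) (wfIC (M := M) (p := p) (q := q))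

/-! #### Correctness -/

/-- Renaming the variables of a CNF along an injection preserves satisfiability (through
`PropForm.ofCNF` and `PropForm.Satisfiable.mapVars`). [folklore] -/
theorem satisfiable_map_renLit_iff {ν μ : Type} {f : ν → μ} (hf : Function.Injective f) (φ : CNF ν) :
    CNF.Satisfiable (φ.map fun c => c.map (renLit f)) ↔ φ.Satisfiable := by
  have key : ∀ {κ : Type} (ψ : CNF κ), ψ.Satisfiable ↔ (PropForm.ofCNF ψ).Satisfiable := fun ψ => by
    unfold CNF.Satisfiable PropForm.Satisfiable; simp only [PropForm.eval_ofCNF]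
  rw [key, key, ← mapVars_ofCNF]
  exact ⟨PropForm.Satisfiable.of_mapVars _, PropForm.Satisfiable.mapVars hf⟩

variable (M p q) in
/-- **Correctness of the reduction** (`x ∈ L ⇔ φₓ ∈ SAT`, Arora–Barak 2009, eq. (2.1)): if `M`
computes `f` within time `q`, then `reduceSAT x ∈ SAT` iff some certificate `u` with
`|u| ≤ p(|x|)` has `f ⟨x, u⟩ = true`. [cite: AroraBarakCC2009, Lemma 2.11 (proof, §2.3.4)] -/
theorem reduceSAT_mem_SAT_iff {f : List Bool → Bool}
    (hM : ∀ a : List Bool, M.OutputsWithin a [f a] (q.eval a.length)) (x : List Bool) :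
    reduceSAT M p q x ∈ SAT ↔ ∃ u : List Bool, u.length ≤ p.eval x.length ∧ f (boolPair x u) = true := by
  rw [reduceSAT, mem_SAT_iff, cnfN, satisfiable_map_renLit_iff (renM_injective M)]
  have hrun : ∀ u : List Bool, u.length ≤ PP p x.length →
      M.OutputsWithin (boolPair x u) [f (boolPair x u)] (TT p q x.length) := fun u hu =>
    (hM (boolPair x u)).mono (TM2Iter.eval_mono q (by rw [length_boolPair, NN, PP] at *; omega))
  exact satisfiable_tableauCNF_iff x _ _ hrun

end Concrete

end CookLevin

end Literature.Computability.Complexity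

namespace Literature.Computability.Complexity

open CookLevin

/-- **Arora–Barak 2009, Lemma 2.11: `SAT` is NP-hard — discharged.** For `L ∈ NP = polyExists P`
with verifier language `L' ∈ P` and certificate polynomial `p`, `mem_P_iff_holds` gives a
`FinTM2` decider `M` of `L'` with time polynomial `q`; the Karp reduction is `reduceSAT M p q`
(`reduceSAT_mem_FP`, `reduceSAT_mem_SAT_iff`), fed to the skeleton `isNPHard_SAT_of_polyExists`
of `CookLevin.lean`. [cite: AroraBarakCC2009, Lemma 2.11] -/
theorem SAT_isNPHard_holds : SAT_isNPHard := by
  refine isNPHard_SAT_of_polyExists fun L' p hL' => ?_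
  obtain ⟨q, Mx, hM⟩ := mem_P_iff_holds.1 hL'
  refine ⟨reduceSAT Mx p q, reduceSAT_mem_FP Mx p q, fun x => ?_⟩
  refine Iff.trans ?_ (reduceSAT_mem_SAT_iff Mx p q
    (f := fun a => (L' : Set (List Bool)).boolIndicator a) (fun a => hM a) x).symm
  exact exists_congr fun u => and_congr Iff.rfl (Set.mem_iff_boolIndicator (L' : Set (List Bool)) (boolPair x u))

/-- **The Cook–Levin theorem from `SAT ∈ NP`**: with Lemma 2.11 discharged, the NP-completeness of
`SAT` (`isNPComplete_SAT`, Arora–Barak 2009, Thm. 2.10 (1)) follows from the fact `SAT_mem_NP`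
(`CNF.lean`) alone. [cite: AroraBarakCC2009, Thm. 2.10] -/
theorem isNPComplete_SAT_of_SAT_mem_NP (h : SAT_mem_NP) : isNPComplete_SAT :=
  isNPComplete_SAT_of h SAT_isNPHard_holds

end Literature.Computability.Complexity
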